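import Mathlib
import HarnessLib

/-!
# Bombieri–Friedlander–Iwaniec 1986, §17: the combinatorial skeleton of the proof of Theorem 10

Trunk `AntSieve`, companion to `Literature.NumberTheory.Sieve.BombieriFriedlanderIwaniec` and
`Literature.NumberTheory.Sieve.BombieriFriedlanderIwaniecDispersion`.  Everything here is PROVED.

In §17 (Acta Math. 156 (1986), p. 249) Theorem 10 is reduced to Theorems 1, 2 and 5* as follows.
After Heath-Brown's identity (Lemma 5, `J = 7`) and the partition of §15, one faces products
`M₁ ⋯ M_j N₁ ⋯ N_j = x` with `M_i = x^{μ_i}`, `N_i = x^{ν_i}`, `μ_i ≤ 1/7`, exponents summing to `1`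
((15.6)).  Theorem 1 applies to a block `N = x^λ` (a partial product) when `x^{2/7−ε} < N < x^{3/7+ε}`
((17.1)), Theorem 2 when `x^{1/7−ε} < N < x^{2/7+ε}` ((17.2)), with `R = x^{−ε} N`,
`Q ≤ x^{4/7−4ε} N^{−1}`; and "if there exists a partial sum `λ` of (15.6) with `1/7 ≤ λ ≤ 3/7`
((17.3)) then (17.1) and (17.2) complete the proof.  Suppose there is no partial sum of (15.6) in
(17.3).  All the terms `μ_i` and those `λ_i ≤ 1/7` give in total, say `τ`, with `τ ≤ 1/7` ((17.4)).
Hence `ν₁ ≥ 3/7` and Theorem 5* is applicable with `M = N₁ = x^{ν₁} ≥ x^{3/7}` and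
`Q, R ≤ x^{2/7−2ε}`."

## Contents

* `Literature.NumberTheory.Sieve.BFI.exists_subsum_mem_Icc_or` — the partial-sum dichotomy behind (17.3)–(17.4), for a
  finite family of reals and thresholds `0 < a`, `2a ≤ b`: either some partial sum lies in
  `[a, b]`, or the terms `< a` total `< a` and every term `≥ a` is `> b`.
* `Literature.NumberTheory.Sieve.BFI.section17_dichotomy` — the case split of §17 for exponents summing to `1`: either a partial
  sum lies in `[1/7, 3/7]` (Theorems 1, 2), or some single exponent exceeds `3/7` (Theorem 5*), the
  remaining ones then totalling `< 4/7`.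
* `Literature.NumberTheory.Sieve.BFI.range_theorem1_of_mem`, `Literature.NumberTheory.Sieve.BFI.range_theorem2_of_mem`, `Literature.NumberTheory.Sieve.BFI.range_theorem5_of_gt`
  — the exponent arithmetic of (17.1), (17.2) and of the applicability of Theorem 5*: with the
  choices `R = x^{σ−2ε}`, `Q = x^{4/7−4ε−σ}` (so `QR = x^{4/7−6ε}`) the range conditions of
  Theorems 1, 2 (`Literature.BombieriFriedlanderIwaniecTheorem1/2`, slack `ε`) hold on the logarithmic scale
  for `σ ∈ (2/7 − ε, 3/7 + ε)`, resp. `σ ∈ (1/7 − ε, 2/7 + ε)`, and condition (12.5) of Theorem 5*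
  holds for `M = x^ν`, `ν > 3/7`, `Q, R ≤ x^{2/7−2ε}`.  (Pure linear arithmetic in the exponents; the
  analytic bookkeeping — rounding of dyadic scales, `x` large — belongs to the assembly of Theorem 10.)

## References

* E. Bombieri, J. B. Friedlander, H. Iwaniec, *Primes in arithmetic progressions to large moduli*,
  Acta Math. 156 (1986), 203–251, §17 (p. 249) and §15 (15.6). [BombieriFriedlanderIwaniecActa1986]
-/

open Finset

namespace Literature.NumberTheory.Sieve

namespace BFI

/-! ### The partial-sum dichotomy -/

/-- **Partial-sum dichotomy** (the combinatorial step of BFI §17, p. 249, in general form).  Let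
`f : ι → ℝ` be a family of reals on a finite index type (no sign condition is needed) and `0 < a`,
`2a ≤ b`.  Then either some partial sum `∑_{i ∈ s} f i` lies in `[a, b]`, or else the terms `< a`
have total `< a` and every term `≥ a` is in fact `> b`.  (Proof: if the small terms totalled `≥ a`,
add them one at a time; the first partial sum reaching `a` is `< 2a ≤ b`.)  [cite: BombieriFriedlanderIwaniecActa1986, §17 (17.3)–(17.4) p. 249] -/
theorem exists_subsum_mem_Icc_or {ι : Type*} [Fintype ι] [DecidableEq ι] (f : ι → ℝ)
    {a b : ℝ} (ha : 0 < a) (hab : 2 * a ≤ b) :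
    (∃ s : Finset ι, a ≤ ∑ i ∈ s, f i ∧ ∑ i ∈ s, f i ≤ b) ∨
      ((∑ i ∈ univ.filter (fun i => f i < a), f i) < a ∧ ∀ i, a ≤ f i → b < f i) := by
  by_cases hgood : ∃ s : Finset ι, a ≤ ∑ i ∈ s, f i ∧ ∑ i ∈ s, f i ≤ b
  · exact Or.inl hgood
  refine Or.inr ⟨?_, fun i hi => ?_⟩
  · -- induction over the set of small indices
    have key : ∀ t : Finset ι, (∀ i ∈ t, f i < a) → ∑ i ∈ t, f i < a := by
      intro t
      induction t using Finset.induction_on with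
      | empty => intro _; simpa using ha
      | @insert i t hit ih =>
        intro hsmall
        have ht : ∑ j ∈ t, f j < a := ih fun j hj => hsmall j (mem_insert_of_mem hj)
        have hi : f i < a := hsmall i (mem_insert_self i t)
        rw [sum_insert hit]
        by_contra hge
        push Not at hge
        exact hgood ⟨insert i t, by rwa [sum_insert hit], by rw [sum_insert hit]; linarith⟩
    exact key _ fun i hi => (mem_filter.1 hi).2
  · by_contra hle
    push Not at hle
    exact hgood ⟨{i}, by simpa using hi, by simpa using hle⟩

/-- **BFI §17, the case split for Theorem 10** (p. 249).  Let the exponents `f i` of a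
decomposition `M₁ ⋯ M_j N₁ ⋯ N_j = x` sum to `1` ((15.6); no sign condition is needed).  Then either some partial sum lies in
`[1/7, 3/7]` ((17.3): Theorems 1 and 2 apply, (17.1)–(17.2)), or some single exponent is `> 3/7`
("hence `ν₁ ≥ 3/7` and Theorem 5* is applicable"), in which case the other exponents total `< 4/7`.
(In the source the `μ_i` are `≤ 1/7`, so the large exponent is one of the `ν_i`; this is not needed
for the dichotomy.)  PROVED from `exists_subsum_mem_Icc_or` with `a = 1/7`, `b = 3/7`.
[cite: BombieriFriedlanderIwaniecActa1986, §17 p. 249] -/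
theorem section17_dichotomy {ι : Type*} [Fintype ι] [DecidableEq ι] (f : ι → ℝ)
    (hsum : ∑ i, f i = 1) :
    (∃ s : Finset ι, 1 / 7 ≤ ∑ i ∈ s, f i ∧ ∑ i ∈ s, f i ≤ 3 / 7) ∨
      ∃ i, 3 / 7 < f i ∧ ∑ j ∈ univ.erase i, f j < 4 / 7 := by
  rcases exists_subsum_mem_Icc_or f (a := 1 / 7) (b := 3 / 7) (by norm_num) (by norm_num) with
    h | ⟨hsmall, hbig⟩
  · exact Or.inl h
  right
  -- some term is `≥ 1/7` (otherwise all terms are small and total `< 1/7 < 1`), hence `> 3/7`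
  have hex : ∃ i, 1 / 7 ≤ f i := by
    by_contra hnone
    push Not at hnone
    have hall : univ.filter (fun i => f i < 1 / 7) = univ := by
      ext i
      simp only [mem_filter, mem_univ, true_and, iff_true]
      exact hnone i
    rw [hall] at hsmall
    linarith
  obtain ⟨i, hi⟩ := hex
  refine ⟨i, hbig i hi, ?_⟩
  have h3 := hbig i hi
  have : ∑ j ∈ univ.erase i, f j = 1 - f i := by
    rw [← hsum, ← Finset.sum_erase_add _ _ (mem_univ i)]; ring
  rw [this]
  linarith

/-! ### The exponent arithmetic of (17.1), (17.2) and of Theorem 5* -/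

/-- **(17.1)** (BFI p. 249: "Theorem 1 is applicable if `x^{2/7−ε} < N < x^{3/7+ε}`", with
`R = x^{−ε} N`, `Q ≤ x^{4/7−4ε} N^{−1}`), as exponent arithmetic.  Write `N = x^σ`, `R = x^r`,
`Q = x^q` with `r = σ − 2ε`, `q = 4/7 − 4ε − σ`.  If `2/7 − ε < σ < 3/7 + ε` and `0 < ε ≤ 1/50`, then the
logarithmic forms of the hypotheses of `Literature.NumberTheory.Sieve.BombieriFriedlanderIwaniecTheorem1` with slack `ε`
hold with room to spare: (A₁) `ε ≤ σ ≤ 1 − ε`; `q + r < 1`; `ε + r < σ` (i.e. `x^ε R < N`);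
`σ + ε < 1/2 − q/2`, `σ + ε < 2 − 5q − r`, `σ + ε < 1 − 2q − r/2` (the three upper bounds), in the
forms `σ + ε + ε/2 ≤ 1/2 − q/2` (this bound is equivalent to `σ ≤ 3/7 + ε`) and `… + ε ≤ …` for the
other two. PROVED (linear arithmetic).
[cite: BombieriFriedlanderIwaniecActa1986, §17 (17.1) p. 249] -/
theorem range_theorem1_of_mem {ε σ : ℝ} (hε : 0 < ε) (hε' : ε ≤ 1 / 50)
    (h1 : 2 / 7 - ε < σ) (h2 : σ < 3 / 7 + ε) :
    let r := σ - 2 * ε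
    let q := 4 / 7 - 4 * ε - σ
    ε ≤ σ ∧ σ ≤ 1 - ε ∧ q + r < 1 ∧ ε + r + ε ≤ σ ∧
      σ + ε + ε / 2 ≤ 1 / 2 - q / 2 ∧ σ + ε + ε ≤ 2 - 5 * q - r ∧ σ + ε + ε ≤ 1 - 2 * q - r / 2 := by
  refine ⟨by linarith, by linarith, by linarith, by linarith, by linarith, by linarith, by linarith⟩

/-- **(17.2)** (BFI p. 249: "Theorem 2 is applicable if `x^{1/7−ε} < N < x^{2/7+ε}`"), as exponent
arithmetic with the same choices `r = σ − 2ε`, `q = 4/7 − 4ε − σ`.  If `1/7 − ε < σ < 2/7 + ε` and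
`0 < ε ≤ 1/50`, then: `ε ≤ σ ≤ 1 − ε`; `q + r < 1`; `ε + r < σ`; and the three upper bounds of
`Literature.NumberTheory.Sieve.BombieriFriedlanderIwaniecTheorem2` in logarithmic form: `σ + ε + ε ≤ (1 + r − 2q)/2`,
`σ + ε < (2/5)(1 − q)`, `σ + ε + ε ≤ (2 − 3q)/4`.  (The middle bound is the binding one: it is
equivalent to `σ < 2/7 + ε`, so no room is left there beyond the strict inequality.)
PROVED (linear arithmetic).
[cite: BombieriFriedlanderIwaniecActa1986, §17 (17.2) p. 249] -/
theorem range_theorem2_of_mem {ε σ : ℝ} (hε : 0 < ε) (hε' : ε ≤ 1 / 50)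
    (h1 : 1 / 7 - ε < σ) (h2 : σ < 2 / 7 + ε) :
    let r := σ - 2 * ε
    let q := 4 / 7 - 4 * ε - σ
    ε ≤ σ ∧ σ ≤ 1 - ε ∧ q + r < 1 ∧ ε + r + ε ≤ σ ∧
      σ + ε + ε ≤ (1 + r - 2 * q) / 2 ∧ σ + ε < 2 / 5 * (1 - q) ∧ σ + ε + ε ≤ (2 - 3 * q) / 4 := by
  refine ⟨by linarith, by linarith, by linarith, by linarith, by linarith, by linarith, by linarith⟩

/-- **Applicability of Theorem 5*** in §17 (BFI p. 249: "Hence `ν₁ ≥ 3/7` and Theorem 5* is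
applicable with `M = N₁ = x^{ν₁} ≥ x^{3/7}` and `Q, R ≤ x^{2/7−2ε}`"), as exponent arithmetic for
condition (12.5), `M > x^ε max {Q, x^{−1} Q R⁴, Q^{1/2} R, x^{−2} Q³ R⁴}`: if `ν > 3/7`,
`q, r ≤ 2/7 − 2ε` and `0 < ε ≤ 1/50` then `ε + q < ν`, `ε + (q + 4r − 1) < ν`, `ε + (q/2 + r) < ν`
and `ε + (3q + 4r − 2) < ν`.  PROVED (linear arithmetic).
[cite: BombieriFriedlanderIwaniecActa1986, §17 p. 249; §12 (12.5) p. 237] -/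
theorem range_theorem5_of_gt {ε ν q r : ℝ} (hε : 0 < ε) (hε' : ε ≤ 1 / 50) (hν : 3 / 7 < ν)
    (hq : q ≤ 2 / 7 - 2 * ε) (hr : r ≤ 2 / 7 - 2 * ε) :
    ε + q < ν ∧ ε + (q + 4 * r - 1) < ν ∧ ε + (q / 2 + r) < ν ∧ ε + (3 * q + 4 * r - 2) < ν := by
  refine ⟨by linarith, by linarith, by linarith, by linarith⟩

end BFI

end Literature.NumberTheory.Sieve
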